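import Literature.Analysis.UnboundedOperators.LinearizedBoltzmann
import Literature.Analysis.FluidPDE.HardSpherePhaseSpace
import HarnessLib

/-!
# The ring operator of a hard-sphere gas at first order in the density, and its zero-frequency value

Topic `Literature/MathematicalPhysics/KineticTheory`; definition request `defn-ZeroFrequencyRingOperator`
(route `JParityClosure` of `AtomisticToContinuum/HydrodynamicLimit`, to type its foreseen layer-2 item
`FirstOrderOddResponse`: "the J-odd projection of the first-order-in-φ non-equilibrium contact
correlation (zero-frequency ring / three-body operator), as a linear functional of the one-body
deviation"). Velocity AND position space: one finite-dimensional real inner product space `E`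
(`ℝ³` in the route); spheres of diameter `σ`; the reference state is the unit Maxwellian
`M(v) dv = stdGaussian E` at unit density, as for `hardSphereLinearizedOp` (rescale with
`toPeculiar` / multiply by `n²` downstream).

## The objects (Ernst's binary-collision-operator language)

Hard-sphere dynamics acts on reduced distribution functions through the binary collision operators
`T̄(ij) = σ^{d-1} ∫_{v_ij·σ̂>0} dσ̂ (v_ij·σ̂) [δ(r_ij - σσ̂) b_σ̂ - δ(r_ij + σσ̂)]`
(van Noije–Ernst 1998 (12) at restitution `α = 1`; Ernst 1998 (24); `b_σ̂` = the elastic reflection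
`collide σ̂`, a *real* collision at contact `r_ij = σσ̂`, minus the *virtual* collision at `r_ij = -σσ̂`),
and the first two hard-sphere BBGKY equations read `(∂ₜ + L⁰₁) f₁ = ∫ dx₂ T̄(12) f₁₂`,
`(∂ₜ + L⁰₁₂ - T̄(12)) f₁₂ = ∫ dx₃ [T̄(13) + T̄(23)] f₁₂₃` (van Noije–Ernst (19)). Writing
`f₁₂ = f₁f₂ + g₁₂`, `f₁₂₃ = f₁f₂f₃ + f₁g₂₃ + f₂g₁₃ + f₃g₁₂` (pair correlations kept, `g₁₂₃` dropped)
gives the **ring kinetic equations** (van Noije–Ernst (26)–(27) = Ernst (28)):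
`(∂ₜ + L⁰₁) f₁ = ∫ dx₂ T̄(12)(f₁f₂ + g₁₂)`,
`[∂ₜ + L⁰₁₂ - T̄(12) - (1 + P₁₂) ∫ dx₃ T̄(13)(1 + P₁₃) f₃] g₁₂ = T̄(12) f₁f₂`.
Solving the second for `g₁₂` at frequency `z` (Laplace variable) and substituting in the first yields
the generalised Boltzmann equation in ring approximation, whose collision term beyond Enskog–Boltzmann,
linearised at `f = n M (1 + h)`, is `n² M₁ ⁻¹ ∫ dx₂ T̄(12) 𝒢 T̄(12) M₁M₂ (h₁ + h₂)` with the damped pair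
propagator `𝒢 = [z + L⁰₁₂ - T̄(12) - nΛ(1) - nΛ(2)]⁻¹`, `Λ(i) = ∫ dx₃ T̄(i3)(1 + P_{i3}) M₃` — the **ring
operator** `R_n(z)` (Kawasaki–Oppenheim 1967 (41)–(42): `∫ ⟨0|T₁₂ Ḡ₀ 𝓛̄ G₀ T₁₂|0⟩ φ(p₂) dp₂`,
`Ḡ₀ = [ε + iL₀ + ρ𝓛̄]⁻¹`, `𝓛̄ = 𝓛_B(p₁) + 𝓛_B(p₂)`; Ernst–Dorfman 1972; Dorfman–Cohen 1972/1975). Two hard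
spheres collide at most once under free flight, `T̄(12) S⁰ₜ(12) T̄(12) = 0` (van Noije–Ernst after
(13)), so the expansion of `R_n(z)` in the density starts with ONE intermediate collision:
`R_n(z) = n · T̄(12) G_z [Λ(1) + Λ(2)] G_z T̄(12)(1 + P₁₂) + O(n²)`, `G_z = ∫₀^∞ e^{-zt} S⁰₋ₜ(12) dt`:
the **three-body ring events** — recollisions `(12)(13)(12)`, `(12)(23)(12)` (direct terms) and cyclic
collisions `(23)(31)(12)`, `(13)(32)(12)` (exchange terms `P₁₃`, `P₂₃`), each intermediate and initial
collision real or virtual — with free flight in between (Cohen 1967 §2 figs. 2a–2b; Ernst 1998 §4–§5 and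
(17): their phase space is finite in `d = 3` and log-divergent in `d = 2`). Its value at `z = 0` is
the **zero-frequency ring operator at first order in the density**, `zeroFrequencyRingOperator σ h`,
the dynamic-correlation ("ring", "recollision") part of the first density correction `n²(…)` to the
linearised collision operator `n L` of `hardSphereLinearizedOp` (the static, excluded-volume part being
Enskog's, `linearizedEnskogOperatorDeloc`); it carries the coefficient `η₁` of Ernst (15)/(19) together
with the Enskog terms (van Beijeren–Ernst 1973; Sengers' evaluations, Ernst §4).

This file makes that expansion term EXPLICIT and delta-free, at function level (Bochner integrals,
junk value `0` where an integral diverges), in five steps, for a one-body velocity deviation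
`h : E → ℝ` (zero wavenumber) and pair functions `Ψ ρ (v₁, v₂)` of the RELATIVE position `ρ = r₁ - r₂`:

1. `encounterDiscr`, `backwardEntryTime`, `backwardExitTime` — the geometry of the backward free
   flight `ρ - t(v₁ - v₂)` of a pair against the contact sphere `|ρ| = σ`;
2. `pastEncounterOp σ z H = G_z T̄(12) H` in closed form: integrating the contact deltas of `T̄(12)`
   along the backward free flight leaves (Jacobian `|v₁₂·σ̂|` against the weight `(v₁₂·σ̂)₊`) the value
   `e^{-z t₋} H(b p) - e^{-z t₊} H(p)` on pairs whose straight backward paths interpenetrate — the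
   real collision at the entry time `t₋` (velocities restituted by `reflectVel`) minus the virtual one
   at the exit time `t₊` (Cohen 1967 fig. 2: "real or imaginary (hypothetical)" collisions) — and `0`
   otherwise: the two-body dynamic pair correlation `γ⁽⁰⁾[H]`;
3. `pairEnskogOp σ Ψ = [Λ(1) + Λ(2)] Ψ` — a Maxwellian third sphere collides (really at `r₃ = rᵢ - σω`,
   virtually at `r₃ = rᵢ + σω`, weight `((vᵢ - v₃)·ω)₊ = hardSphereKernel`) with particle `i = 1, 2` of
   the pair; direct terms (the pair keeps its correlation, one velocity reflected) and exchange terms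
   (`P_{i3}`: the fresh particle inherits the correlation its partner `3` had with the spectator), the
   third sphere being forbidden to overlap the spectator (overlap function `W`, van Noije–Ernst (5),
   (15): reduced distributions of hard spheres vanish on overlapping configurations);
4. `freeFlightResolvent z Ψ = G_z Ψ = ∫₀^∞ e^{-zt} Ψ(ρ - t(v₁ - v₂), v₁, v₂) dt` and
   `ringPairCorrelation σ z h = G_z [Λ(1)+Λ(2)] G_z T̄(12)(h₁ + h₂)` — the first-order (three-body)
   non-equilibrium pair correlation `γ⁽¹⁾[h](ρ, v₁, v₂)` per unit `n³ M₁ M₂`, at frequency `z`;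
5. `ringOperator σ z h (v₁) = σ^{d-1} ∫ dM(v₂) ∫ dω ((v₁-v₂)·ω)₊ [γ⁽¹⁾(σω, b_ω(v₁,v₂)) - γ⁽¹⁾(-σω, v₁, v₂)]`
   `= M₁⁻¹ ∫ dx₂ T̄(12) M₁M₂ γ⁽¹⁾[h]` and `zeroFrequencyRingOperator σ h = ringOperator σ 0 h`.
   The final `T̄(12)` reads `γ⁽¹⁾` only at PRE-collisional contact configurations (`ringOperator`
   evaluates `ringPairCorrelation` at `(σω, b_ω p)` and `(-σω, p)` with `((v₁-v₂)·ω)₊ > 0`), which is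
   the "first-order non-equilibrium contact correlation" the requesting item speaks of.

PROVED here: unfolding lemmas; homogeneity `R(c • h) = c • R h` of every stage; the backward-flight
facts `backwardEntry/ExitTime` same sign off the ball and `σ < |±σω - t g|` along the backward flight
from a pre-collisional contact; `pastEncounterOp σ z H = 0` off the interpenetration set and, at
`z = 0`, `pastEncounterOp σ 0 (h ⊕ h) ρ p = 0` for `σ < |ρ|` when `h` is a collision invariant; whence
**`zeroFrequencyRingOperator σ φ = 0` for every collision invariant `φ`** (`1, v, |v|²`: shifted
equilibria carry no dynamic correlation at pre-collisional contact) — the "kills the collision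
invariants" half of the requesting item, which holds pointwise, every integrand vanishing.

## Conventions and design choices

* ORDER IN DENSITY. With `f = nM(1+h)` the ring-approximation collision term is
  `n L♭_σ h + n² R₁(z) h + O(n³ log n)` (`d = 3`), `L♭_σ` = linearised Enskog–Boltzmann operator at
  `Y = 1` (`linearizedEnskogOperatorDeloc`, not repeated here), `R₁ = ringOperator σ z`: NO density
  parameter appears in this file. The resummed operator `R_n(z)` with the Boltzmann-damped propagator
  (needed in `d = 2`, for long-time tails, and at `O(n³ log n)`) is NOT constructed — TODO(general
  form): it requires the evolution semigroup of `L⁰₁₂ - nΛ(1) - nΛ(2)` on pair functions.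
* WHAT IS NOT A RING EVENT. Sequences of four binary collisions among three spheres (dynamically
  possible for hard spheres) and the dropped triplet correlation `g₁₂₃` belong to the complete
  Choh–Uhlenbeck triple-collision operator `K(fff)` (Ernst (13)–(14)) but not to the ring operator
  (Ernst §10, last sentence: the ring equations do not account for the full `η₁`); the static
  (excluded-volume, `h`-on-the-third-particle) channel of the same closure is Enskog's and lives in
  `LinearizedEnskogOperator.lean`. Only the dynamic channel — `h` entering through the colliding pair —
  is the ring operator.
* OVERLAP EXCLUSION (the one deliberate refinement of the printed closure). The two-body function
  `γ⁽⁰⁾ = G T̄(12)(h ⊕ h)` (`pastEncounterOp`) has two regimes: OFF the core `|ρ| > σ` it is the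
  dynamic correlation of a pair with a common collision history (real minus virtual past collision);
  INSIDE the core only the virtual term survives and `γ⁽⁰⁾ = -(h(v₁) + h(v₂))` is the linearised
  excluded-volume hole `f₁₂ - f₁f₂ = -f₁f₂`, a STATIC correlation. The closure (27) as printed
  carries no overlap function and would let the third sphere read `γ⁽⁰⁾` inside the core of the
  spectator (configurations on which `f₁₂₃` vanishes identically: van Noije–Ernst (15), (19), the
  overlap function `W_N` standing to the left of the `T̄`'s) — feeding Enskog-type shielding terms
  into the operator. We keep the factor `W(r₃ - r_spectator)` (`overlapFn`, strict inequality) on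
  every third-sphere term of `Λ(1) + Λ(2)`, so that ONLY the off-core, dynamic values of `γ⁽⁰⁾` are
  propagated: this is the ring (collision-history) channel proper, all excluded-volume statistics
  being left to the Enskog terms; it is also what makes `R₁(0)` annihilate the collision invariants
  integrand by integrand (`zeroFrequencyRingOperator_eq_zero_of_isCollisionInvariant`). Dropping the
  two `overlapFn` factors gives the verbatim linearisation of (27).
* FREQUENCY. `z` is real, `e^{-zt}`; `z = 0` is the improper integral over `t ∈ (0, ∞)` (Bochner on
  `Ioi 0`; for `d ≥ 3` and bounded `h` the contact values converge absolutely — solid angle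
  `(σ/|v₁₂|t)^{d-1}`, Ernst (17) — in `d = 2` they do not, Cohen 1967 (12a), and the junk value `0`
  results). The first resolvent is absorbed by the contact deltas (step 2), so only ONE time integral
  remains; `R₁` scales as `σ^{2d-1}` at `z = 0`.
* SIGNS as in `hardSphereLinearizedOp`: gain minus loss, the linearisation of `+Q`; cross-section
  factors `σ^{d-1}` ARE included here (the diameter also enters the geometry, it cannot be factored).
* Positions and velocities live in the same space `E`; the unit Maxwellian weights `stdGaussian E`
  are probability measures, `sphereMeasure` is the surface measure of `S^{d-1}`.
* Junk values: `backwardEntry/ExitTime` are `0` for `v₁ = v₂` (division by `‖0‖²`), and then no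
  encounter is recorded; `reflectVel 0 = id`.

## References

* T. P. C. van Noije, M. H. Ernst, *Ring kinetic theory for an idealized granular gas*, Physica A 251
  (1998) 266–283 = arXiv:cond-mat/9706020, §II (5)–(8), (11)–(15), §III (19), (23), (25)–(27).
* M. H. Ernst, *Bogoliubov Choh Uhlenbeck theory: cradle of modern kinetic theory*, in Progress in
  Statistical Physics (World Scientific, 1998) = arXiv:cond-mat/9707146, §4 (11)–(15), §5 (16)–(19),
  §10 (24)–(28).
* K. Kawasaki, I. Oppenheim, *Logarithmic terms in the density expansions of transport coefficients*,
  in Statistical Mechanics, Foundations and Applications (IUPAP Copenhagen 1966), Benjamin 1967,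
  313–334: (3)–(4), (40)–(42).
* E. G. D. Cohen, *On the non-existence of density expansions for the transport coefficients in
  classical gases*, ibid. 291–312: §2 (6)–(7), (11)–(12), figs. 2a–2b, §4c.
* H. van Beijeren, M. H. Ernst, *The modified Enskog equation*, Physica 68 (1973) 437–456.
* J. R. Dorfman, E. G. D. Cohen, Phys. Rev. A 6 (1972) 776–790; M. H. Ernst, J. R. Dorfman, Physica 61
  (1972) 157–181.
-/

open MeasureTheory Metric Real ProbabilityTheory Module
open scoped InnerProductSpace

namespace Literature.MathematicalPhysics.KineticTheory

noncomputable section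

open Literature.Analysis.UnboundedOperators Literature.Analysis.FluidPDE

variable {E : Type*} [NormedAddCommGroup E] [InnerProductSpace ℝ E]

/-! ### §1. Backward free flight of a pair against the contact sphere -/

/-- Discriminant of `|ρ - t g|² = σ²` in `t` (divided by `4`): `⟪ρ, g⟫² - |g|² (|ρ|² - σ²)`, for the
relative position `ρ = r₁ - r₂` and relative velocity `g = v₁ - v₂` of a pair of spheres of diameter
`σ`; it is positive iff the straight relative path `ρ - t g` crosses the open ball of radius `σ`
(Cohen 1967 §2, fig. 3: the collision cylinder). [cite: Cohen1967, §2 fig. 3] -/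
def encounterDiscr (σ : ℝ) (ρ g : E) : ℝ :=
  ⟪ρ, g⟫_ℝ ^ 2 - ‖g‖ ^ 2 * (‖ρ‖ ^ 2 - σ ^ 2)

/-- The **backward entry time** `t₋ = (⟪ρ, g⟫ - √Δ)/|g|²`: flying the pair backwards along straight
lines, `ρ(t) = ρ - t g`, the first time at which `|ρ(t)| = σ` with `|ρ(t)|` decreasing, i.e. contact
with `g·σ̂ > 0`, `σ̂ = ρ(t₋)/σ` — in forward time the instant of the (real) collision of which the
present velocities are the outcome. Junk `0` when `g = 0`. [cite: Cohen1967, §2 fig. 2a] -/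
def backwardEntryTime (σ : ℝ) (ρ g : E) : ℝ :=
  (⟪ρ, g⟫_ℝ - √(encounterDiscr σ ρ g)) / ‖g‖ ^ 2

/-- The **backward exit time** `t₊ = (⟪ρ, g⟫ + √Δ)/|g|²`: the later time at which the straight
backward relative path leaves the ball, `|ρ(t₊)| = σ` with `|ρ(t)|` increasing, i.e. `ρ(t₊) = -σσ̂` with
`g·σ̂ > 0` — in forward time the instant at which transparent spheres on the same straight paths would
have touched: the virtual ("imaginary", "hypothetical") collision. Junk `0` when `g = 0`.
[cite: Cohen1967, §2 fig. 2b] -/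
def backwardExitTime (σ : ℝ) (ρ g : E) : ℝ :=
  (⟪ρ, g⟫_ℝ + √(encounterDiscr σ ρ g)) / ‖g‖ ^ 2

/-- The **overlap function** `W(x) = 1` if `σ < |x|`, `0` otherwise (van Noije–Ernst 1998 (5); strict
inequality: contact configurations are null). [cite: VanNoijeErnst1998, (5)] -/
def overlapFn (σ : ℝ) (x : E) : ℝ :=
  if σ < ‖x‖ then 1 else 0

omit [InnerProductSpace ℝ E] in
/-- `W` takes the values `0` and `1`. [folklore] -/
theorem overlapFn_eq_one_or_eq_zero (σ : ℝ) (x : E) :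
    overlapFn σ x = 1 ∨ overlapFn σ x = 0 := by
  unfold overlapFn; split_ifs <;> simp

/-- The discriminant is at most `⟪ρ, g⟫²` off the closed ball: `σ < |ρ|`, `0 ≤ σ` give
`Δ ≤ ⟪ρ, g⟫²`, with equality only for `g = 0`. [folklore] -/
theorem encounterDiscr_le_inner_sq {σ : ℝ} (hσ : 0 ≤ σ) {ρ : E} (hρ : σ < ‖ρ‖) (g : E) :
    encounterDiscr σ ρ g ≤ ⟪ρ, g⟫_ℝ ^ 2 := by
  unfold encounterDiscr
  have h1 : σ ^ 2 < ‖ρ‖ ^ 2 := by nlinarith [norm_nonneg ρ]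
  nlinarith [sq_nonneg ‖g‖, mul_nonneg (sq_nonneg ‖g‖) (sub_pos.2 h1).le]

/-- Off the closed ball (`0 ≤ σ < |ρ|`) the two backward contact times have the same sign: the pair
met in the past by a real collision iff its straight paths interpenetrated, i.e.
`(0 < Δ ∧ 0 < t₋) ↔ (0 < Δ ∧ 0 < t₊)`. This is why the two-body correlation of a shifted equilibrium
vanishes off the ball (`pastEncounterOp_pairSum_eq_zero_of_isCollisionInvariant`). [folklore] -/
theorem backwardEntryTime_pos_iff {σ : ℝ} (hσ : 0 ≤ σ) {ρ : E} (hρ : σ < ‖ρ‖) (g : E) :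
    (0 < encounterDiscr σ ρ g ∧ 0 < backwardEntryTime σ ρ g) ↔
      (0 < encounterDiscr σ ρ g ∧ 0 < backwardExitTime σ ρ g) := by
  by_cases hg : g = 0
  · subst hg
    simp [backwardEntryTime, backwardExitTime]
  have hg2 : 0 < ‖g‖ ^ 2 := by positivity
  have hΔle := encounterDiscr_le_inner_sq hσ hρ g
  constructor
  · rintro ⟨hΔ, ht⟩
    refine ⟨hΔ, ?_⟩
    unfold backwardEntryTime at ht
    unfold backwardExitTime
    have hnum : 0 < ⟪ρ, g⟫_ℝ - √(encounterDiscr σ ρ g) := (div_pos_iff_of_pos_right hg2).1 ht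
    have hs : 0 ≤ √(encounterDiscr σ ρ g) := Real.sqrt_nonneg _
    exact div_pos (by linarith) hg2
  · rintro ⟨hΔ, ht⟩
    refine ⟨hΔ, ?_⟩
    unfold backwardExitTime at ht
    unfold backwardEntryTime
    have hnum : 0 < ⟪ρ, g⟫_ℝ + √(encounterDiscr σ ρ g) := (div_pos_iff_of_pos_right hg2).1 ht
    -- `√Δ < |⟪ρ,g⟫|` and `⟪ρ,g⟫ + √Δ > 0` force `⟪ρ,g⟫ > √Δ`.
    have hslt : √(encounterDiscr σ ρ g) < |⟪ρ, g⟫_ℝ| := by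
      have h1 : σ ^ 2 < ‖ρ‖ ^ 2 := by nlinarith [norm_nonneg ρ]
      have hlt : encounterDiscr σ ρ g < ⟪ρ, g⟫_ℝ ^ 2 := by
        unfold encounterDiscr
        nlinarith [mul_pos hg2 (sub_pos.2 h1)]
      calc √(encounterDiscr σ ρ g) < √(⟪ρ, g⟫_ℝ ^ 2) :=
            Real.sqrt_lt_sqrt hΔ.le hlt
        _ = |⟪ρ, g⟫_ℝ| := Real.sqrt_sq_eq_abs _
    have hpos : 0 < ⟪ρ, g⟫_ℝ := by
      rcases le_or_gt ⟪ρ, g⟫_ℝ 0 with h | h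
      · rw [abs_of_nonpos h] at hslt
        linarith [Real.sqrt_nonneg (encounterDiscr σ ρ g)]
      · exact h
    rw [abs_of_pos hpos] at hslt
    exact div_pos (by linarith) hg2

/-- Along the backward free flight from a PRE-collisional contact configuration the pair stays
strictly outside the contact sphere: for `0 < σ`, a unit vector `ω`, relative position `-σω` and
relative velocity `g` with `0 < ⟪g, ω⟫` (approaching; the loss configuration of `ringOperator`, where
the kernel `((v₁-v₂)·ω)₊` is positive), `σ < |-σω - t g|` for every `t > 0`. [folklore] -/
theorem lt_norm_neg_smul_sub_smul {σ : ℝ} (hσ : 0 < σ) (ω : sphere (0 : E) 1) {g : E}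
    (hg : 0 < ⟪g, (ω : E)⟫_ℝ) {t : ℝ} (ht : 0 < t) :
    σ < ‖-(σ • (ω : E)) - t • g‖ := by
  have hωω : ⟪(ω : E), (ω : E)⟫_ℝ = 1 := real_inner_self_sphere ω
  have hsq : σ ^ 2 < ‖-(σ • (ω : E)) - t • g‖ ^ 2 := by
    rw [← real_inner_self_eq_norm_sq]
    simp only [inner_sub_left, inner_sub_right, inner_neg_left, inner_neg_right, inner_smul_left,
      inner_smul_right, hωω, RCLike.conj_to_real, real_inner_comm g (ω : E)]
    nlinarith [real_inner_self_nonneg (x := g), mul_pos hσ (mul_pos ht hg),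
      mul_nonneg (mul_nonneg ht.le ht.le) (real_inner_self_nonneg (x := g))]
  exact lt_of_pow_lt_pow_left₀ 2 (norm_nonneg _) hsq

/-- The gain-term companion: from the contact configuration `+σω` with the RESTITUTED velocities
of `ringOperator`'s gain term, whose relative velocity `g'` has `⟪g', ω⟫ < 0` (again approaching),
the backward flight stays outside: `σ < |σω - t g'|` for every `t > 0`. [folklore] -/
theorem lt_norm_smul_sub_smul {σ : ℝ} (hσ : 0 < σ) (ω : sphere (0 : E) 1) {g : E}
    (hg : ⟪g, (ω : E)⟫_ℝ < 0) {t : ℝ} (ht : 0 < t) :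
    σ < ‖σ • (ω : E) - t • g‖ := by
  have h := lt_norm_neg_smul_sub_smul hσ ω (g := -g) (by simpa [inner_neg_left] using hg) ht
  have heq : -(σ • (ω : E)) - t • (-g) = -(σ • (ω : E) - t • g) := by
    simp only [smul_neg]; abel
  rwa [heq, norm_neg] at h

/-! ### §2. The free-flight resolvent `G_z`; the two-body dynamic correlation `G_z T̄(12) H` in closed form -/

/-- The pair observable `(h ⊕ h)(v₁, v₂) = h(v₁) + h(v₂)` — the linearisation
`f₁f₂ = n²M₁M₂(1 + h₁ + h₂) + O(h²)` through which the one-body deviation drives the pair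
correlation (`T̄(12) f₁f₂`, van Noije–Ernst 1998 (27), right-hand side). [cite: VanNoijeErnst1998, (27)] -/
def pairSum (h : E → ℝ) (p : E × E) : ℝ :=
  h p.1 + h p.2

/-- **`G_z T̄(12)`, the two-body dynamic pair correlation.** For a pair at relative position `ρ` with
velocities `p = (v₁, v₂)`, `g = v₁ - v₂`:
`e^{-z t₋} H(b p) · 𝟙[real past collision] - e^{-z t₊} H(p) · 𝟙[straight paths interpenetrated]`,
where `t∓` are the backward entry/exit times, the indicator conditions are `0 < Δ ∧ 0 < t∓`, and
`b = reflectVel (ρ - t₋ g)` restitutes the velocities the pair had before its collision at backward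
time `t₋` (impact direction `σ̂ = (ρ - t₋g)/σ`). This is the free-flight resolvent
`G_z = ∫₀^∞ e^{-zt} S⁰₋ₜ(12) dt` applied to `T̄(12) H`,
`T̄(12) = σ^{d-1}∫_{g·σ̂>0} dσ̂ (g·σ̂)[δ(ρ - σσ̂) b_σ̂ - δ(ρ + σσ̂)]` (van Noije–Ernst 1998 (12), `α = 1`):
the contact deltas absorb the time and angle integrals with Jacobian `σ^{d-1}|g·σ̂|`, which the
weight `(g·σ̂)₊` cancels, the admissible roots being the entry point (real term) and the exit point
(virtual term) — Cohen's real and hypothetical binary collisions (Cohen 1967 §2, figs. 2a–2b).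
[cite: VanNoijeErnst1998, (11)–(12)] -/
def pastEncounterOp (σ z : ℝ) (H : E × E → ℝ) (ρ : E) (p : E × E) : ℝ :=
  (if 0 < encounterDiscr σ ρ (p.1 - p.2) ∧ 0 < backwardEntryTime σ ρ (p.1 - p.2) then
      exp (-(z * backwardEntryTime σ ρ (p.1 - p.2))) *
        H (reflectVel (ρ - backwardEntryTime σ ρ (p.1 - p.2) • (p.1 - p.2)) p)
    else 0) -
    (if 0 < encounterDiscr σ ρ (p.1 - p.2) ∧ 0 < backwardExitTime σ ρ (p.1 - p.2) then
      exp (-(z * backwardExitTime σ ρ (p.1 - p.2))) * H p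
    else 0)

/-- Homogeneity of `G_z T̄(12)` in the pair observable. [folklore] -/
theorem pastEncounterOp_smul (σ z c : ℝ) (H : E × E → ℝ) (ρ : E) (p : E × E) :
    pastEncounterOp σ z (c • H) ρ p = c * pastEncounterOp σ z H ρ p := by
  unfold pastEncounterOp
  simp only [Pi.smul_apply, smul_eq_mul]
  split_ifs <;> ring

/-- `G_z T̄(12) 0 = 0`. [folklore] -/
@[simp]
theorem pastEncounterOp_zero (σ z : ℝ) (ρ : E) (p : E × E) :
    pastEncounterOp σ z (0 : E × E → ℝ) ρ p = 0 := by
  unfold pastEncounterOp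
  split_ifs <;> simp

/-- A pair that did not interpenetrate in the past (`¬ 0 < Δ`, e.g. `v₁ = v₂`) carries no two-body
correlation. [folklore] -/
theorem pastEncounterOp_eq_zero_of_discr_nonpos {σ : ℝ} (z : ℝ) (H : E × E → ℝ) {ρ : E} {p : E × E}
    (h : encounterDiscr σ ρ (p.1 - p.2) ≤ 0) : pastEncounterOp σ z H ρ p = 0 := by
  unfold pastEncounterOp
  rw [if_neg (fun hc => absurd hc.1 (not_lt.2 h)), if_neg (fun hc => absurd hc.1 (not_lt.2 h)),
    sub_zero]

/-- A collision invariant is blind to the elastic reflection with ANY impact direction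
(`reflectVel n = collide (n/|n|)` for `n ≠ 0`, the identity for `n = 0`). [cite: CIP1994, §3.1] -/
theorem pairSum_reflectVel_of_isCollisionInvariant {φ : E → ℝ} (hφ : IsCollisionInvariant φ)
    (n : E) (p : E × E) : pairSum φ (reflectVel n p) = pairSum φ p := by
  by_cases hn : n = 0
  · subst hn; simp [pairSum]
  · rw [reflectVel_eq_collide_unitDir n hn]
    exact hφ _ p

/-- **Shifted equilibria carry no two-body correlation off the ball at zero frequency.** For a
collision invariant `φ` (`φ(v₁') + φ(v₂') = φ(v₁) + φ(v₂)`), `0 ≤ σ < |ρ|`: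
`pastEncounterOp σ 0 (φ ⊕ φ) ρ p = 0` — real and virtual terms then carry the same observable and the
same indicator (`backwardEntryTime_pos_iff`). (Inside the ball only the virtual term survives: the
excluded-volume hole `W - 1`, the static correlation.) [folklore] -/
theorem pastEncounterOp_pairSum_eq_zero_of_isCollisionInvariant {σ : ℝ} (hσ : 0 ≤ σ) {φ : E → ℝ}
    (hφ : IsCollisionInvariant φ) {ρ : E} (hρ : σ < ‖ρ‖) (p : E × E) :
    pastEncounterOp σ 0 (pairSum φ) ρ p = 0 := by
  unfold pastEncounterOp
  simp only [zero_mul, neg_zero, exp_zero, one_mul, pairSum_reflectVel_of_isCollisionInvariant hφ]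
  rw [sub_eq_zero]
  by_cases hc : 0 < encounterDiscr σ ρ (p.1 - p.2) ∧ 0 < backwardEntryTime σ ρ (p.1 - p.2)
  · rw [if_pos hc, if_pos ((backwardEntryTime_pos_iff hσ hρ _).1 hc)]
  · rw [if_neg hc, if_neg (fun h' => hc ((backwardEntryTime_pos_iff hσ hρ _).2 h'))]

/-- **The free two-particle resolvent** `G_z Ψ (ρ, p) = ∫₀^∞ e^{-zt} Ψ(ρ - t(v₁ - v₂), p) dt`
(`G_z = (z + L⁰₁₂)⁻¹ = ∫₀^∞ e^{-zt} S⁰₋ₜ(12) dt` in the relative coordinate, `S⁰ₜ` the free streaming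
operator, van Noije–Ernst 1998 (7); Kawasaki–Oppenheim 1967 `G₀ = (ε + iL₀)⁻¹`). Improper Bochner
integral on `Ioi 0`, junk `0` if divergent; `z = 0` is the zero-frequency value.
[cite: KawasakiOppenheim1967, (3) and before (42)] -/
def freeFlightResolvent (z : ℝ) (Ψ : E → E × E → ℝ) (ρ : E) (p : E × E) : ℝ :=
  ∫ t in Set.Ioi (0 : ℝ), exp (-(z * t)) * Ψ (ρ - t • (p.1 - p.2)) p

/-- Homogeneity of `G_z`. [folklore] -/
theorem freeFlightResolvent_smul (z c : ℝ) (Ψ : E → E × E → ℝ) (ρ : E) (p : E × E) :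
    freeFlightResolvent z (c • Ψ) ρ p = c * freeFlightResolvent z Ψ ρ p := by
  unfold freeFlightResolvent
  rw [← integral_const_mul]
  refine integral_congr_ae (Filter.Eventually.of_forall fun t => ?_)
  simp only [Pi.smul_apply, smul_eq_mul]
  ring

/-! ### §3. One intermediate collision with a Maxwellian third sphere: `Λ(1) + Λ(2)` -/

variable [FiniteDimensional ℝ E] [MeasurableSpace E] [BorelSpace E]

/-- **`[Λ(1) + Λ(2)] Ψ`, the linearised Enskog–Boltzmann operator of the ring equation acting on a
pair function** `Ψ(ρ, (v₁, v₂))` (`ρ = r₁ - r₂`): `Λ(i) = ∫ dx₃ T̄(i3)(1 + P_{i3}) M₃`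
(van Noije–Ernst 1998 (27), the `f₃`-term, linearised at `f₃ = nM₃`, per unit density;
Kawasaki–Oppenheim 1967 (39)–(40)), written out with
`T̄(13) = σ^{d-1} ∫ dω ((v₁-v₃)·ω)₊ [δ(r₁₃ - σω) b_ω - δ(r₁₃ + σω)]`: the third sphere `w ∼ M` meets
particle `1` at `r₃ = r₁ - σω` (real, velocities `(v₁', w') = collide ω (v₁, w)`) or sits at
`r₃ = r₁ + σω` (virtual); the *direct* terms keep `Ψ` on the pair `(1,2)` with `v₁ ↦ v₁'`, the
*exchange* terms (`P₁₃`) read the correlation of `3` with the spectator `2`, at relative position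
`r₃ - r₂ = ρ ∓ σω`; likewise for particle `2` (`T̄(23)`, `P₂₃`, relative positions `r₁ - r₃ = ρ ± σω`).
Each term carries the overlap function `W(r₃ - r_spectator)` (van Noije–Ernst (5), (15): `f₁₂₃`
vanishes when the third sphere overlaps the spectator). Integrals: `w ∼ stdGaussian E`,
`ω ∼ sphereMeasure`; junk `0` if divergent. [cite: VanNoijeErnst1998, (27)] -/
def pairEnskogOp (σ : ℝ) (Ψ : E → E × E → ℝ) (ρ : E) (p : E × E) : ℝ :=
  σ ^ (finrank ℝ E - 1) *
    ∫ w, ∫ ω,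
      (hardSphereKernel (p.1, w) ω *
          (overlapFn σ (ρ - σ • (ω : E)) *
              (Ψ ρ ((collide ω (p.1, w)).1, p.2) + Ψ (ρ - σ • (ω : E)) ((collide ω (p.1, w)).2, p.2)) -
            overlapFn σ (ρ + σ • (ω : E)) * (Ψ ρ p + Ψ (ρ + σ • (ω : E)) (w, p.2))) +
        hardSphereKernel (p.2, w) ω *
          (overlapFn σ (ρ + σ • (ω : E)) *
              (Ψ ρ (p.1, (collide ω (p.2, w)).1) + Ψ (ρ + σ • (ω : E)) (p.1, (collide ω (p.2, w)).2)) -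
            overlapFn σ (ρ - σ • (ω : E)) * (Ψ ρ p + Ψ (ρ - σ • (ω : E)) (p.1, w))))
      ∂sphereMeasure ∂(stdGaussian E)

/-- Homogeneity of `Λ(1) + Λ(2)`. [folklore] -/
theorem pairEnskogOp_smul (σ c : ℝ) (Ψ : E → E × E → ℝ) (ρ : E) (p : E × E) :
    pairEnskogOp σ (c • Ψ) ρ p = c * pairEnskogOp σ Ψ ρ p := by
  unfold pairEnskogOp
  simp only [Pi.smul_apply, smul_eq_mul]
  conv_rhs => rw [mul_left_comm, ← integral_const_mul]
  congr 1
  refine integral_congr_ae (Filter.Eventually.of_forall fun w => ?_)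
  dsimp only
  rw [← integral_const_mul]
  refine integral_congr_ae (Filter.Eventually.of_forall fun ω => ?_)
  dsimp only
  ring

/-- If `Ψ` vanishes off the closed contact ball, so does `[Λ(1) + Λ(2)] Ψ`: every evaluation of `Ψ`
in `pairEnskogOp` is either at `ρ` itself or guarded by the overlap function of its own position.
[folklore] -/
theorem pairEnskogOp_eq_zero_of_forall {σ : ℝ} {Ψ : E → E × E → ℝ}
    (hΨ : ∀ ρ' p', σ < ‖ρ'‖ → Ψ ρ' p' = 0) {ρ : E} (hρ : σ < ‖ρ‖) (p : E × E) :
    pairEnskogOp σ Ψ ρ p = 0 := by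
  unfold pairEnskogOp
  have hW : ∀ (x : E) (q : E × E), overlapFn σ x * Ψ x q = 0 := fun x q => by
    unfold overlapFn
    split_ifs with hx
    · rw [hΨ x q hx, mul_zero]
    · rw [zero_mul]
  have h0 : ∀ q : E × E, Ψ ρ q = 0 := fun q => hΨ ρ q hρ
  refine mul_eq_zero_of_right _ (integral_eq_zero_of_ae (Filter.Eventually.of_forall fun w => ?_))
  simp only [Pi.zero_apply]
  refine integral_eq_zero_of_ae (Filter.Eventually.of_forall fun ω => ?_)
  simp only [Pi.zero_apply, mul_add, hW, h0, mul_zero, add_zero, sub_self]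

/-! ### §4. The first-order (three-body) pair correlation -/

/-- **The first-order non-equilibrium pair correlation** (three-body ring events) driven by the
one-body deviation `h`, per unit `n³ M(v₁) M(v₂)`, at frequency `z`:
`γ⁽¹⁾[h] = G_z [Λ(1) + Λ(2)] G_z T̄(12) (h ⊕ h)` — the `O(n)` term of
`[z + L⁰₁₂ - T̄(12) - nΛ(1) - nΛ(2)]⁻¹ T̄(12)(h ⊕ h)` (van Noije–Ernst 1998 (27) solved for `g₁₂`;
the repeated-ring `T̄(12)` does not contribute at this order since `T̄ G T̄ = 0`). As a function of
the relative position `ρ` and the velocities. [cite: VanNoijeErnst1998, (26)–(27)] -/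
def ringPairCorrelation (σ z : ℝ) (h : E → ℝ) : E → E × E → ℝ :=
  freeFlightResolvent z (pairEnskogOp σ (pastEncounterOp σ z (pairSum h)))

/-- Homogeneity of `γ⁽¹⁾`. [folklore] -/
theorem ringPairCorrelation_smul (σ z c : ℝ) (h : E → ℝ) (ρ : E) (p : E × E) :
    ringPairCorrelation σ z (c • h) ρ p = c * ringPairCorrelation σ z h ρ p := by
  unfold ringPairCorrelation
  have h1 : pairSum (c • h) = c • pairSum h := by
    funext q; simp only [pairSum, Pi.smul_apply, smul_eq_mul]; ring
  have h2 : pastEncounterOp σ z (c • pairSum h) = c • pastEncounterOp σ z (pairSum h) := by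
    funext ρ' q; exact pastEncounterOp_smul σ z c _ ρ' q
  have h3 : pairEnskogOp σ (c • pastEncounterOp σ z (pairSum h)) =
      c • pairEnskogOp σ (pastEncounterOp σ z (pairSum h)) := by
    funext ρ' q; exact pairEnskogOp_smul σ c _ ρ' q
  rw [h1, h2, h3, freeFlightResolvent_smul]

/-! ### §5. The ring operator at first order in the density; zero frequency -/

/-- **The ring operator of the hard-sphere gas at first order in the density, at frequency `z`:**
`R₁(z) h (v₁) = σ^{d-1} ∫ dM(v₂) ∫ dω ((v₁-v₂)·ω)₊ [γ⁽¹⁾[h](σω, b_ω(v₁,v₂)) - γ⁽¹⁾[h](-σω, (v₁,v₂))]`,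
i.e. `M₁⁻¹ ∫ dx₂ T̄(12) (n-free part of g₁₂)` with `γ⁽¹⁾ = ringPairCorrelation σ z h`: the three-body
ring events `T̄(12) G_z [Λ(1)+Λ(2)] G_z T̄(12)(1 + P₁₂)` with Maxwellian partners — recollisions and
cyclic collisions, real or virtual, free flight in between (Kawasaki–Oppenheim 1967 (3), (41) expanded
to first order in `ρ`; Ernst 1998 §4–§5; Cohen 1967 §2). The linearised ring-approximation collision
operator is `n L♭_σ + n² R₁(z) + O(n³ log n)` in `d = 3`. The final `T̄(12)` reads `γ⁽¹⁾` at the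
pre-collisional contact configurations only: both evaluation points are of the form
`(relative position -σn̂, velocities q)` with `(q₁ - q₂)·n̂ > 0` (`n̂ = ω` for the loss term, `n̂ = -ω`,
`q = b_ω(v₁, v₂)` for the gain term), so the datum entering `R₁` is the single function
`(n̂, q) ↦ ringPairCorrelation σ z h (-(σ • n̂)) q` on the pre-collisional hemisphere — the
first-order non-equilibrium contact correlation. [cite: KawasakiOppenheim1967, (3), (41)–(42)] -/
def ringOperator (σ z : ℝ) (h : E → ℝ) (v : E) : ℝ :=
  σ ^ (finrank ℝ E - 1) *
    ∫ w, ∫ ω, hardSphereKernel (v, w) ω *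
      (ringPairCorrelation σ z h (σ • (ω : E)) (collide ω (v, w)) -
        ringPairCorrelation σ z h (-(σ • (ω : E))) (v, w)) ∂sphereMeasure ∂(stdGaussian E)

/-- **The zero-frequency ring operator** of the hard-sphere gas at first order in the density:
`R₁(0)`, the `z → 0⁺` (here: `z = 0`, improper time integral) value of `ringOperator` — the
dynamic-correlation part of the first density correction to the linearised hard-sphere collision
operator, entering the first density corrections `η₁, λ₁, D₁` of the transport coefficients next to
Enskog's static terms (Ernst 1998 (15), (19), §4; van Beijeren–Ernst 1973). Finite for `d = 3`,
log-divergent (junk `0`) for `d = 2` (Cohen 1967 (11)–(12); Ernst (17)). [cite: Ernst1998BCU, §4–§5 (15)–(19)] -/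
def zeroFrequencyRingOperator (σ : ℝ) (h : E → ℝ) : E → ℝ :=
  ringOperator σ 0 h

/-- Unfolding `zeroFrequencyRingOperator`. [folklore] -/
theorem zeroFrequencyRingOperator_def (σ : ℝ) (h : E → ℝ) :
    zeroFrequencyRingOperator σ h = ringOperator σ 0 h :=
  rfl

/-- Homogeneity `R₁(z)(c • h) = c • R₁(z) h` (no integrability needed; additivity would need it).
[folklore] -/
theorem ringOperator_smul (σ z c : ℝ) (h : E → ℝ) (v : E) :
    ringOperator σ z (c • h) v = c * ringOperator σ z h v := by
  unfold ringOperator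
  simp only [ringPairCorrelation_smul]
  conv_rhs => rw [mul_left_comm, ← integral_const_mul]
  congr 1
  refine integral_congr_ae (Filter.Eventually.of_forall fun w => ?_)
  dsimp only
  rw [← integral_const_mul]
  refine integral_congr_ae (Filter.Eventually.of_forall fun ω => ?_)
  dsimp only
  ring

/-- `R₁(0)(c • h) = c • R₁(0) h`. [folklore] -/
theorem zeroFrequencyRingOperator_smul (σ c : ℝ) (h : E → ℝ) :
    zeroFrequencyRingOperator σ (c • h) = c • zeroFrequencyRingOperator σ h := by
  funext v
  simp only [zeroFrequencyRingOperator, Pi.smul_apply, smul_eq_mul, ringOperator_smul]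

/-- `R₁(z) 0 = 0`. [folklore] -/
@[simp]
theorem ringOperator_zero (σ z : ℝ) : ringOperator σ z (0 : E → ℝ) = 0 := by
  funext v
  have h := ringOperator_smul σ z 0 (0 : E → ℝ) v
  rw [zero_smul, zero_mul] at h
  exact h

/-- At zero frequency the first-order pair correlation of a shifted equilibrium vanishes at every
configuration reached by flying the pair backwards OUTSIDE the contact ball: if `σ < |ρ - t g|` for all
`t > 0` then `γ⁽¹⁾[φ](ρ, p) = 0` for a collision invariant `φ`. [folklore] -/
theorem ringPairCorrelation_eq_zero_of_isCollisionInvariant {σ : ℝ} (hσ : 0 ≤ σ) {φ : E → ℝ}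
    (hφ : IsCollisionInvariant φ) {ρ : E} {p : E × E}
    (hout : ∀ t : ℝ, 0 < t → σ < ‖ρ - t • (p.1 - p.2)‖) :
    ringPairCorrelation σ 0 φ ρ p = 0 := by
  unfold ringPairCorrelation freeFlightResolvent
  refine setIntegral_eq_zero_of_forall_eq_zero fun t ht => ?_
  rw [pairEnskogOp_eq_zero_of_forall (fun ρ' p' hρ' =>
    pastEncounterOp_pairSum_eq_zero_of_isCollisionInvariant hσ hφ hρ' p') (hout t (Set.mem_Ioi.1 ht)),
    mul_zero]

/-- **The zero-frequency ring operator annihilates the collision invariants**: for `0 < σ` and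
`φ` with `φ(v₁') + φ(v₂') = φ(v₁) + φ(v₂)` (`1`, `⟪b, v⟫`, `|v|²`: `isCollisionInvariant_quadratic`),
`zeroFrequencyRingOperator σ φ = 0` — a shifted Maxwellian generates no dynamic correlation at
pre-collisional contact (every integrand vanishes: off the ball the real and virtual two-body terms
cancel for an invariant, the third sphere never overlaps the spectator, and the backward flight from a
pre-collisional contact stays off the ball). The density expansion of the collision operator vanishes
on Maxwellians order by order (Ernst 1998 §3–§4). [cite: Ernst1998BCU, §4] -/
theorem zeroFrequencyRingOperator_eq_zero_of_isCollisionInvariant {σ : ℝ} (hσ : 0 < σ) {φ : E → ℝ}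
    (hφ : IsCollisionInvariant φ) : zeroFrequencyRingOperator σ φ = 0 := by
  funext v
  simp only [zeroFrequencyRingOperator, ringOperator, Pi.zero_apply]
  refine mul_eq_zero_of_right _ (integral_eq_zero_of_ae (Filter.Eventually.of_forall fun w => ?_))
  simp only [Pi.zero_apply]
  refine integral_eq_zero_of_ae (Filter.Eventually.of_forall fun ω => ?_)
  simp only [Pi.zero_apply]
  by_cases hg : 0 < ⟪v - w, (ω : E)⟫_ℝ
  · -- positive kernel: both contact configurations are pre-collisional
    have hgain : ringPairCorrelation σ 0 φ (σ • (ω : E)) (collide ω (v, w)) = 0 := by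
      refine ringPairCorrelation_eq_zero_of_isCollisionInvariant hσ.le hφ fun t ht => ?_
      refine lt_norm_smul_sub_smul hσ ω ?_ ht
      have hωω : ⟪(ω : E), (ω : E)⟫_ℝ = 1 := real_inner_self_sphere ω
      have hg' : 0 < ⟪v, (ω : E)⟫_ℝ - ⟪w, (ω : E)⟫_ℝ := by rwa [← inner_sub_left]
      simp only [collide, inner_sub_left, inner_add_left, inner_smul_left, hωω, RCLike.conj_to_real]
      linarith
    have hloss : ringPairCorrelation σ 0 φ (-(σ • (ω : E))) (v, w) = 0 :=
      ringPairCorrelation_eq_zero_of_isCollisionInvariant hσ.le hφ fun t ht =>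
        lt_norm_neg_smul_sub_smul hσ ω hg ht
    rw [hgain, hloss, sub_self, mul_zero]
  · -- vanishing kernel
    have hk : hardSphereKernel (v, w) ω = 0 := by
      unfold hardSphereKernel
      exact max_eq_right (not_lt.1 hg)
    rw [hk, zero_mul]

end

end Literature.MathematicalPhysics.KineticTheory
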